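import Summits.AnomalousDissipation.AnomalousDissipation.Theorems.MomentParityResolvedDissipationTrajectoryUIOfGalerkinEE
import HarnessLib

/-!
# Stub S13 `stub_trajectoryUIOfGalerkinEEae` for line `enstrophy-ui-transfer` of crux
# `MomentParity.ResolvedDissipation` (stmt-AnomalousDissipation-14284)

Supports stmt-AnomalousDissipation-14284 (stub stub_trajectoryUIOfGalerkinEEae for line enstrophy-ui-transfer,
lead c7). Nothing here closes an item.

**GEE₀ᵃᵉ(ν, f) ⟹ TUI(f, ν, R).** The assembly of
`TrajectoryUIOfGalerkinEE.trajectoryUIAt_of_galerkinLimitEnergyEquality` (lead c6) re-run under the WEAKER leaf: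
the energy equality between positive times is assumed only for coefficientwise limits of Hopf–Galerkin families of
NS(ν, f) (exact steady force) whose data are MEAN-ZERO and converge strongly in `L²` at time `0`, and only between
a.e. PAIRS of positive times `∀ᵐ t₀, ∀ᵐ t₁, 0 < t₀ ≤ t₁ → …`. The c6 proof builds its family from Galerkin orbits of
mean-zero Galerkin modes (zero mean of the data by `Torus.galerkinFlow_zero`) and applies the energy equality at
exactly one pair of strong times `s₁ ∈ (0, min(T_G, 1))`, `s₂ ∈ (1, 2)` picked from a.e.-sets; here those a.e.-sets
are additionally intersected with the outer (in `s₁`) and inner (in `s₂`, for the chosen `s₁`) a.e.-sets of the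
hypothesis. Everything else (S7 bounded orders, S8 strong convergence at `t = 0`, S9 energy passage, S6 Vitali UI,
c5's `N`-uniform local enstrophy bound) is verbatim.
-/

noncomputable section

-- `Summit.<Summit>.<Problem>`: single-conjunct summit, the duplicate namespace segment is mandated.
set_option linter.dupNamespace false

namespace Summit.AnomalousDissipation.AnomalousDissipation.Theorems.MomentParityResolvedDissipation.TrajectoryUIOfGalerkinEEae

open MeasureTheory Filter Topology Set
open scoped ENNReal InnerProductSpace RealInnerProductSpace
open Literature.Analysis.FunctionSpaces Literature.Analysis.FluidPDE
open Summit.AnomalousDissipation.AnomalousDissipation.Theses.MomentParity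
open Summit.AnomalousDissipation.AnomalousDissipation.Theorems.CubicParityLoud.Negative (T3 R3)
open Summit.AnomalousDissipation.AnomalousDissipation.Theorems.MomentParityResolvedDissipation
open Literature.Analysis.FunctionSpaces.Torus Literature.Analysis.FluidPDE.Torus UnitAddTorus
open Summit.AnomalousDissipation.AnomalousDissipation.Theorems.MomentParity

/-- **S13 · `stub_trajectoryUIOfGalerkinEEae` — GEE₀ᵃᵉ(ν, f) ⟹ TUI(f, ν, R)** (line `enstrophy-ui-transfer`,
lead c7, stub S13): c6's assembly `TrajectoryUIOfGalerkinEE.trajectoryUIAt_of_galerkinLimitEnergyEquality` re-run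
under the a.e./mean-zero leaf. The energy equality is assumed only for coefficientwise limits of Hopf–Galerkin
families of NS(ν, f) with the exact steady force and MEAN-ZERO data converging strongly in `L²` at time `0`, and
only between a.e. PAIRS of positive times. The family of the proof consists of Galerkin orbits of mean-zero
Galerkin modes (`TrajectoryUIOfLHEE.isHopfGalerkinFamily_galerkinFlow_of_isGalerkinMode`, zero mean of the data by
`Torus.galerkinFlow_zero`), and the energy equality is used at exactly one pair of STRONG times
`s₁ ∈ (0, min(T_G, 1))`, `s₂ ∈ (1, 2)` picked from a.e.-sets, now intersected with the outer/inner a.e.-sets of the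
hypothesis; S8 at `t = 0`, S9 energy passage, S6 Vitali UI, c5's local bound on `(0, s₁]` and S7 for bounded
orders are unchanged. [folklore argument; RobinsonRodrigoSadowski2016 Thm 4.6; FMRT2001 Ch. IV (1.31)] -/
theorem stub_trajectoryUIOfGalerkinEEae (ν : ℝ) (hν : 0 < ν) (f : T3 → R3) (hf : Torus.IsSmooth f)
    (hf0 : Torus.HasZeroMean f)
    (hGEE : ∀ (u₀ : T3 → R3), MemLp u₀ 2 volume → ∀ (N : ℕ → ℕ) (U : ℕ → ℝ → T3 → R3) (u : ℝ → T3 → R3),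
      IsHopfGalerkinFamily ν (fun _ => f) u₀ N (fun _ _ => f) U →
      (∀ n, Torus.HasZeroMean (U n 0)) →
      AEStronglyMeasurable (Torus.stLift u) (volume.restrict (Set.Ioi (0 : ℝ) ×ˢ Set.univ)) →
      (∀ t, 0 ≤ t → MemLp (u t) 2 volume) →
      (∀ t, 0 ≤ t → ∀ k, Filter.Tendsto
        (fun n => UnitAddTorus.mFourierCoeff (EuclideanSpace.complexify ∘ U n t) k) Filter.atTop
        (𝓝 (UnitAddTorus.mFourierCoeff (EuclideanSpace.complexify ∘ u t) k))) →
      Filter.Tendsto (fun n => eLpNorm (U n 0 - u 0) 2 volume) Filter.atTop (𝓝 0) →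
      ∀ᵐ t₀ ∂(volume : Measure ℝ), ∀ᵐ t₁ ∂(volume : Measure ℝ), 0 < t₀ → t₀ ≤ t₁ →
        Torus.kineticEnergy (u t₁) + ν * (∫⁻ τ in Set.Ioo t₀ t₁, Torus.eGradNormSq (u τ)).toReal =
          Torus.kineticEnergy (u t₀) + ∫ τ in t₀..t₁, ∫ x, ⟪f x, u τ x⟫_ℝ)
    (R : ℝ) :
    ∃ T : ℝ, 0 < T ∧
      ∀ G : ℝ≥0∞, G ≠ ⊤ → ∀ ε : ℝ≥0∞, 0 < ε → ∃ M : ℝ≥0∞, M ≠ ⊤ ∧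
        ∀ (N : ℕ) (a : UnitAddTorus (Fin 3) → EuclideanSpace ℝ (Fin 3)),
          IsGalerkinMode N a → Torus.HasZeroMean a → ∫ x, ‖a x‖ ^ 2 ≤ R ^ 2 →
          Torus.eGradNormSq a ≤ G →
          ∫⁻ t in Set.Ioo 0 T, (Set.Ioi M).indicator id
              (Torus.eGradNormSq (Torus.galerkinFlow ν f N t a)) ≤ ε := by
  refine ⟨1, one_pos, fun G hG ε hε => ?_⟩
  by_contra H
  push Not at H
  -- violators at every natural threshold `m`
  choose Nf af hmode hmean hball hens hviol using fun m : ℕ => H (m : ℝ≥0∞) (ENNReal.natCast_ne_top m)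
  -- the `N`-uniform local enstrophy bound (lead c5): `Z ≤ L` on `[0, TG]` along every violator
  obtain ⟨TG, hTG, hloc⟩ :=
    Summit.AnomalousDissipation.AnomalousDissipation.Theorems.MomentParityResolvedDissipation.TrajectoryUILocalWindow.galerkin_enstrophy_local_bound
      hν hf hf0 (G := G.toReal) ENNReal.toReal_nonneg
  have hGof : ENNReal.ofReal G.toReal = G := ENNReal.ofReal_toReal hG
  set L : ℝ≥0∞ := ENNReal.ofReal (2 * G.toReal + 1)
  have hlocm : ∀ m, ∀ t ∈ Icc (0 : ℝ) TG,
      Torus.eGradNormSq (Torus.galerkinFlow ν f (Nf m) t (af m)) ≤ L := fun m t ht =>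
    hloc (Nf m) (af m) (hmode m) (hmean m) (by rw [hGof]; exact hens m) t ht
  by_cases hbdd : ∃ N₀, ∀ m, Nf m ≤ N₀
  · -- bounded orders: S7 makes the integrand vanish at a large threshold
    obtain ⟨N₀, hN₀⟩ := hbdd
    obtain ⟨M₀, hM₀, hbound⟩ := BoundedOrders.stub_boundedOrders ν hν.le f hf R N₀ 1 zero_le_one
    obtain ⟨m, hm⟩ := ENNReal.exists_nat_gt hM₀
    have hzero : ∫⁻ t in Ioo (0 : ℝ) 1, (Ioi (m : ℝ≥0∞)).indicator id
        (Torus.eGradNormSq (Torus.galerkinFlow ν f (Nf m) t (af m))) = 0 := by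
      refine setLIntegral_eq_zero measurableSet_Ioo fun t ht => ?_
      have hle : Torus.eGradNormSq (Torus.galerkinFlow ν f (Nf m) t (af m)) ≤ (m : ℝ≥0∞) :=
        (hbound (Nf m) (hN₀ m) (af m) (hmode m) (hball m) t ⟨ht.1.le, ht.2.le⟩).trans hm.le
      exact indicator_of_notMem (fun hgt : _ < _ => absurd hle (not_le.2 hgt)) id
    have hv := hviol m
    rw [hzero] at hv
    exact absurd hv (not_lt.2 bot_le)
  · -- unbounded orders: pass to a subsequence with `N → ∞`
    push Not at hbdd
    obtain ⟨ψ, hψ, hNψ⟩ := TrajectoryUIOfLHEE.exists_strictMono_tendsto_of_forall_exists_lt hbdd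
    set N : ℕ → ℕ := Nf ∘ ψ
    set a : ℕ → T3 → R3 := af ∘ ψ
    set U : ℕ → ℝ → T3 → R3 := fun j t => Torus.galerkinFlow ν f (N j) t (a j)
    have hF : IsHopfGalerkinFamily ν (fun _ => f) (fun _ => EuclideanSpace.single (0 : Fin 3) R) N
        (fun _ _ => f) U :=
      TrajectoryUIOfLHEE.isHopfGalerkinFamily_galerkinFlow_of_isGalerkinMode hν.le hf hNψ (fun j => hmode (ψ j))
        fun j => hball (ψ j)
    have hu₀ : MemLp (fun _ : T3 => EuclideanSpace.single (0 : Fin 3) R) 2 volume := memLp_const _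
    have hfm := Literature.Analysis.FluidPDE.aestronglyMeasurable_stLift_const hf
      (volume.restrict (Ioi (0 : ℝ) ×ˢ univ))
    have hf₂ : ∀ T : ℝ, 0 < T → ∫⁻ _ in Ioo (0 : ℝ) T, ∫⁻ x, ‖f x‖ₑ ^ 2 < ⊤ := fun T _ =>
      lintegral_force_lt_top hf T
    -- the limit field along `φ₁`
    obtain ⟨φ₁, hφ₁, u, hum, hu2, hcv⟩ := hF.exists_limitField hν.le hu₀ hfm hf₂
    have hF₁ := hF.comp_strictMono hφ₁
    -- strong `L²` convergence at a.e. time of `(0, 2)` along `φ₂`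
    obtain ⟨φ₂, hφ₂, hae⟩ :=
      hF₁.exists_strictMono_ae_tendsto_eLpNorm hν hu₀ hfm hf₂ hum hu2 hcv (T := 2) two_pos
    set Φ : ℕ → ℕ := φ₁ ∘ φ₂
    have hF₂ : IsHopfGalerkinFamily ν (fun _ => f) (fun _ => EuclideanSpace.single (0 : Fin 3) R)
        (N ∘ Φ) (fun _ _ => f) (U ∘ Φ) := hF₁.comp_strictMono hφ₂
    have hcv₂ : ∀ t, 0 ≤ t → ∀ k, Tendsto
        (fun j => mFourierCoeff (EuclideanSpace.complexify ∘ (U ∘ Φ) j t) k) atTop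
        (𝓝 (mFourierCoeff (EuclideanSpace.complexify ∘ u t) k)) :=
      fun t ht k => (hcv t ht k).comp hφ₂.tendsto_atTop
    -- strong convergence at time `0` (S8)
    have h0 : Tendsto (fun j => eLpNorm ((U ∘ Φ) j 0 - u 0) 2 volume) atTop (𝓝 0) := by
      refine InitialStrong.stub_initialStrong G hG (fun j => (U ∘ Φ) j 0) (u 0) (fun j => hF₂.memLp_slice j le_rfl)
        (hu2 0 le_rfl) (fun j => ?_) (hcv₂ 0 le_rfl)
      show Torus.eGradNormSq (Torus.galerkinFlow ν f (N (Φ j)) 0 (a (Φ j))) ≤ G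
      rw [Torus.galerkinFlow_zero]
      exact hens (ψ (Φ j))
    -- the data of the family are mean-zero (Galerkin orbits of mean-zero modes at time `0`)
    have hmean₂ : ∀ j, Torus.HasZeroMean ((U ∘ Φ) j 0) := by
      intro j
      show Torus.HasZeroMean (Torus.galerkinFlow ν f (N (Φ j)) 0 (a (Φ j)))
      rw [Torus.galerkinFlow_zero]
      exact hmean (ψ (Φ j))
    -- the a.e.-pairs energy equality of THIS Galerkin limit (GEE₀ᵃᵉ)
    have hEEae := hGEE _ hu₀ (N ∘ Φ) (U ∘ Φ) u hF₂ hmean₂ hum hu2 hcv₂ h0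
    -- two strong times `s₁ ∈ (0, min TG 1)` and `s₂ ∈ (1, 2)`, inside the a.e.-sets of the energy equality
    set τ : ℝ := min TG 1
    have hτpos : 0 < τ := lt_min hTG one_pos
    have hτ1 : τ ≤ 1 := min_le_right _ _
    have hτG : τ ≤ TG := min_le_left _ _
    have hpick : ∀ α β : ℝ, 0 ≤ α → α < β → β ≤ 2 → ∀ P : ℝ → Prop, (∀ᵐ s ∂(volume : Measure ℝ), P s) →
        ∃ s, (Tendsto (fun j => eLpNorm ((U ∘ φ₁) (φ₂ j) s - u s) 2 volume) atTop (𝓝 0) ∧ P s) ∧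
          s ∈ Ioo α β := by
      intro α β hα hαβ hβ P hP
      have hsub : Ioo α β ⊆ Ioo 0 2 := Ioo_subset_Ioo hα hβ
      have hae' := ae_restrict_of_ae_restrict_of_subset hsub hae
      have hP' : ∀ᵐ s ∂(volume.restrict (Ioo α β)), P s := ae_restrict_of_ae hP
      have hne : NeBot (ae (volume.restrict (Ioo α β))) := by
        rw [ae_neBot, Ne, Measure.restrict_eq_zero, Real.volume_Ioo, ENNReal.ofReal_eq_zero, not_le]
        linarith
      exact ((hae'.and hP').and (ae_restrict_mem measurableSet_Ioo)).exists
    obtain ⟨s₁, ⟨hs₁conv, hs₁EE⟩, hs₁mem⟩ := hpick 0 τ le_rfl hτpos (by linarith) _ hEEae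
    obtain ⟨s₂, ⟨hs₂conv, hs₂EE⟩, hs₂mem⟩ := hpick 1 2 zero_le_one one_lt_two le_rfl _ hs₁EE
    have hs₁pos : 0 < s₁ := hs₁mem.1
    have hs₁₂ : s₁ < s₂ := by linarith [hs₁mem.2, hs₂mem.1]
    -- energy equality of the Galerkin limit on `[s₁, s₂]` (GEE₀ᵃᵉ at the chosen pair) and the energy passage (S9)
    have hEE := hs₂EE hs₁pos hs₁₂.le
    have hconvZ := EnergyPassage.stub_energyPassage ν hν f hf _ hu₀ (N ∘ Φ) (U ∘ Φ) u hF₂ hum hu2 hcv₂ s₁ s₂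
      hs₁pos.le hs₁₂.le hs₁conv hs₂conv hEE
    -- uniform integrability on `(s₁, s₂)` (S6)
    set μ : Measure ℝ := volume.restrict (Ioo s₁ s₂)
    have hsub2 : Ioo s₁ s₂ ⊆ Ioo 0 2 := Ioo_subset_Ioo hs₁pos.le hs₂mem.2.le
    have hg : ∀ j, AEMeasurable (fun t => Torus.eGradNormSq ((U ∘ Φ) j t)) μ := fun j =>
      (hF₂.aemeasurable_eGradNormSq j 2).mono_measure (Measure.restrict_mono hsub2 le_rfl)
    have hh : AEMeasurable (fun t => Torus.eGradNormSq (u t)) μ := by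
      have hcoef : ∀ k, AEStronglyMeasurable
          (fun t => mFourierCoeff (EuclideanSpace.complexify ∘ u t) k) (volume.restrict (Ioi 0)) := by
        intro k
        refine aestronglyMeasurable_of_tendsto_ae atTop
          (fun j => hF₂.aestronglyMeasurable_mFourierCoeff j k) ?_
        filter_upwards [ae_restrict_mem measurableSet_Ioi] with t ht
        exact hcv₂ t (le_of_lt ht) k
      exact (Torus.aemeasurable_eGradNormSq_of_coeff hcoef).mono_measure
        (Measure.restrict_mono (Ioo_subset_Ioi_self.trans (Ioi_subset_Ioi hs₁pos.le)) le_rfl)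
    have hle : ∀ᵐ t ∂μ, Torus.eGradNormSq (u t) ≤
        liminf (fun j => Torus.eGradNormSq ((U ∘ Φ) j t)) atTop := by
      filter_upwards [ae_restrict_mem measurableSet_Ioo] with t ht
      exact eGradNormSq_le_liminf_of_tendsto_mFourierCoeff hcv₂ (hs₁pos.trans ht.1).le
    have hfin : ∫⁻ t, Torus.eGradNormSq (u t) ∂μ ≠ ⊤ :=
      ((lintegral_mono_set hsub2).trans_lt
        (hF₂.lintegral_eGradNormSq_limit_lt_top hν hu₀ hfm hf₂ hcv₂ two_pos)).ne
    have hgfin : ∀ j, ∫⁻ t, Torus.eGradNormSq ((U ∘ Φ) j t) ∂μ ≠ ⊤ := fun j =>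
      ((lintegral_mono_set hsub2).trans_lt (hF₂.lintegral_eGradNormSq_lt_top j 2)).ne
    obtain ⟨C, hC, hUI⟩ := VitaliUI.stub_vitaliUI μ (fun j t => Torus.eGradNormSq ((U ∘ Φ) j t))
      (fun t => Torus.eGradNormSq (u t)) hg hh hle hfin hgfin hconvZ ε hε
    -- the index: threshold above `max C L`
    have hC'top : max C L ≠ ⊤ := max_ne_top hC ENNReal.ofReal_ne_top
    obtain ⟨j, hj⟩ := ENNReal.exists_nat_gt hC'top
    have hjm : ((j : ℕ) : ℝ≥0∞) ≤ ((ψ (Φ j) : ℕ) : ℝ≥0∞) := by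
      exact_mod_cast (hψ.comp (hφ₁.comp hφ₂)).id_le j
    have hthr : max C L ≤ ((ψ (Φ j) : ℕ) : ℝ≥0∞) := hj.le.trans hjm
    have hCm : C ≤ ((ψ (Φ j) : ℕ) : ℝ≥0∞) := (le_max_left _ _).trans hthr
    have hLm : L ≤ ((ψ (Φ j) : ℕ) : ℝ≥0∞) := (le_max_right _ _).trans hthr
    -- the violation at the original index `m = ψ (Φ j)` is contradicted
    have hv := hviol (ψ (Φ j))
    have hcover : Ioo (0 : ℝ) 1 ⊆ Ioc 0 s₁ ∪ Ioo s₁ s₂ := fun t ht =>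
      (le_or_gt t s₁).elim (fun h => Or.inl ⟨ht.1, h⟩) fun h => Or.inr ⟨h, ht.2.trans hs₂mem.1⟩
    have hpiece₁ : ∫⁻ t in Ioc (0 : ℝ) s₁, (Ioi ((ψ (Φ j) : ℕ) : ℝ≥0∞)).indicator id
        (Torus.eGradNormSq (Torus.galerkinFlow ν f (Nf (ψ (Φ j))) t (af (ψ (Φ j))))) = 0 := by
      refine setLIntegral_eq_zero measurableSet_Ioc fun t ht => ?_
      have hle' : Torus.eGradNormSq (Torus.galerkinFlow ν f (Nf (ψ (Φ j))) t (af (ψ (Φ j)))) ≤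
          ((ψ (Φ j) : ℕ) : ℝ≥0∞) :=
        (hlocm (ψ (Φ j)) t ⟨ht.1.le, ht.2.trans (hs₁mem.2.le.trans hτG)⟩).trans hLm
      exact indicator_of_notMem (fun hgt : _ < _ => absurd hle' (not_le.2 hgt)) id
    have hpiece₂ : ∫⁻ t in Ioo s₁ s₂, (Ioi ((ψ (Φ j) : ℕ) : ℝ≥0∞)).indicator id
        (Torus.eGradNormSq (Torus.galerkinFlow ν f (Nf (ψ (Φ j))) t (af (ψ (Φ j))))) ≤ ε := by
      refine le_trans (lintegral_mono fun t => ?_) (hUI j)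
      exact indicator_le_indicator_of_subset (Ioi_subset_Ioi hCm) (fun _ => zero_le) _
    have hbound : ∫⁻ t in Ioo (0 : ℝ) 1, (Ioi ((ψ (Φ j) : ℕ) : ℝ≥0∞)).indicator id
        (Torus.eGradNormSq (Torus.galerkinFlow ν f (Nf (ψ (Φ j))) t (af (ψ (Φ j))))) ≤ ε :=
      calc ∫⁻ t in Ioo (0 : ℝ) 1, (Ioi ((ψ (Φ j) : ℕ) : ℝ≥0∞)).indicator id
            (Torus.eGradNormSq (Torus.galerkinFlow ν f (Nf (ψ (Φ j))) t (af (ψ (Φ j)))))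
          ≤ ∫⁻ t in Ioc (0 : ℝ) s₁ ∪ Ioo s₁ s₂, (Ioi ((ψ (Φ j) : ℕ) : ℝ≥0∞)).indicator id
              (Torus.eGradNormSq (Torus.galerkinFlow ν f (Nf (ψ (Φ j))) t (af (ψ (Φ j))))) :=
            lintegral_mono_set hcover
        _ ≤ (∫⁻ t in Ioc (0 : ℝ) s₁, (Ioi ((ψ (Φ j) : ℕ) : ℝ≥0∞)).indicator id
              (Torus.eGradNormSq (Torus.galerkinFlow ν f (Nf (ψ (Φ j))) t (af (ψ (Φ j)))))) +
            ∫⁻ t in Ioo s₁ s₂, (Ioi ((ψ (Φ j) : ℕ) : ℝ≥0∞)).indicator id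
              (Torus.eGradNormSq (Torus.galerkinFlow ν f (Nf (ψ (Φ j))) t (af (ψ (Φ j))))) :=
            lintegral_union_le _ _ _
        _ ≤ 0 + ε := add_le_add hpiece₁.le hpiece₂
        _ = ε := zero_add ε
    exact absurd hv (not_lt.2 hbound)

end Summit.AnomalousDissipation.AnomalousDissipation.Theorems.MomentParityResolvedDissipation.TrajectoryUIOfGalerkinEEae

end
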